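import Summits.Ventures.PackingBounds.SphericalCodes.DegreeThreeEquality

/-!
# `L₃ − 1` rows: Levenshtein's cubic bound is not attained (integrality of the valencies)

Framing: lottery ticket; floor = certified bounds/negative ranges. Venture `PackingBounds`
(cell `pub-packcert`), spherical-code family, standard-angle grid of the cell (rows `s = 1/n`, `1/5`,
`1/6`, `1/7`, `1/8`, `1/9`).

For each cell `(n, s)` below, the cell's certified Delsarte value is Levenshtein's
`L₃(n, s) = n(1-s)(2+(n+1)s)/(1-ns²)`, an INTEGER `N`, realised by the cubic certificate
`f(t) = (t - s)(t + a)²`, `a = (1+s)/(1+ns)` (`SphericalCodes/Dim*` files and the cell's exact LP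
certificates `certs/codes/code_n<n>_s<p>-<q>.json`). A code of size `N` would be balanced with all
inner products in `{s, -a}` (`degree_three_valency`), so each point would have valencies `A, B ∈ ℕ`
with `A + B = N - 1` and `1 + sA - aB = 0`; in every cell below this `2 × 2` system has no solution
in natural numbers (`omega` after clearing denominators), hence `A(n, s) ≤ N - 1`
(`degree_three_card_le_of_no_valency`). These are kernel forms of the classical observation that
Levenshtein's bound `L₃` is attained only when the derived distance distribution is integral
(Boyvalenkov–Landgev 1995: for `3 ≤ n ≤ 100` seven attained and ten undecided cases; all other
rational cells are non-attainable); the `−1` tables themselves we have not located in print for these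
cells (cell FRESHNESS §16, lead). Cells of the same grid that PASS the integrality test (not treated
here): `(9, 1/9)`: `28` (valencies `21, 6`), `(10, 1/5)`: `56` (`35, 20`), `(15, 1/6)`: `100`
(`64, 35`), `(16, 1/8)`: `77` (`55, 21`), and the attained `(5, 1/5) = 16`, `(6, 1/4) = 27`,
`(22, 1/11) = 100`, `(22, 1/6) = 275`, `(21, 1/9) = 112`, `(21, 1/7) = 162`.

## References
* P. Delsarte, J. M. Goethals, J. J. Seidel, Geom. Dedicata 6 (1977) 363–388, §4. [`DelsarteGoethalsSeidel1977`]
* V. I. Levenshtein, *Designs as maximum codes in polynomial metric spaces*, Acta Appl. Math. 29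
  (1992) 1–82 (codes attaining `L_{2k-1}` are tight designs).
* P. Boyvalenkov, I. Landgev, *On maximal spherical codes I*, LNCS 948 (1995) 158–168.
-/

namespace Summit.Ventures.PackingBounds.SphericalCodes

open Finset Literature.Analysis.SpecialFunctions Literature.Geometry.DiscreteGeometry

/-- **`A(6, arccos 1/9) ≤ 15`**: every finite set of unit vectors of `ℝ^6` with pairwise inner
products `≤ 1 / 9` has at most `15` elements. Levenshtein's `L₃(6, 1 / 9) = 16` (cubic certificate
`(t - 1 / 9)(t + 2 / 3)²`) is not attained: a `16`-point code would give each point valencies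
`A + B = 15`, `1·A + 9 = 6·B`, impossible in natural numbers.
(Integrality test of Boyvalenkov–Landgev 1995 for `L₃`; certified `L₃ − 1` row of the `pub-packcert` grid.) -/
theorem code_dim6_ninth_le_15 (C : Finset (EuclideanSpace ℝ (Fin 6)))
    (h1 : ∀ x ∈ C, ‖x‖ = 1) (h2 : ∀ x ∈ C, ∀ y ∈ C, x ≠ y → inner ℝ x y ≤ 1 / 9) :
    C.card ≤ 15 := by
  have h := degree_three_card_le_of_no_valency (n := 6) (μ := 2) (by norm_num) (by norm_num)
    (1 / 9) (2 / 3) (by norm_num) (by norm_num) (by norm_num) (by norm_num) 16 (by norm_num)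
    (by norm_num)
    (fun A B hAB h => by
      have h' : (1 : ℝ) * A + 9 = 6 * B := by linarith
      have h'' : 1 * A + 9 = 6 * B := by exact_mod_cast h'
      omega)
    C h1 h2
  omega

/-- **`A(6, arccos 1/6) ≤ 18`**: every finite set of unit vectors of `ℝ^6` with pairwise inner
products `≤ 1 / 6` has at most `18` elements. Levenshtein's `L₃(6, 1 / 6) = 19` (cubic certificate
`(t - 1 / 6)(t + 7 / 12)²`) is not attained: a `19`-point code would give each point valencies
`A + B = 18`, `2·A + 12 = 7·B`, impossible in natural numbers.
(Integrality test of Boyvalenkov–Landgev 1995 for `L₃`; certified `L₃ − 1` row of the `pub-packcert` grid.) -/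
theorem code_dim6_sixth_le_18 (C : Finset (EuclideanSpace ℝ (Fin 6)))
    (h1 : ∀ x ∈ C, ‖x‖ = 1) (h2 : ∀ x ∈ C, ∀ y ∈ C, x ≠ y → inner ℝ x y ≤ 1 / 6) :
    C.card ≤ 18 := by
  have h := degree_three_card_le_of_no_valency (n := 6) (μ := 2) (by norm_num) (by norm_num)
    (1 / 6) (7 / 12) (by norm_num) (by norm_num) (by norm_num) (by norm_num) 19 (by norm_num)
    (by norm_num)
    (fun A B hAB h => by
      have h' : (2 : ℝ) * A + 12 = 7 * B := by linarith
      have h'' : 2 * A + 12 = 7 * B := by exact_mod_cast h'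
      omega)
    C h1 h2
  omega

/-- **`A(7, arccos 1/7) ≤ 21`**: every finite set of unit vectors of `ℝ^7` with pairwise inner
products `≤ 1 / 7` has at most `21` elements. Levenshtein's `L₃(7, 1 / 7) = 22` (cubic certificate
`(t - 1 / 7)(t + 4 / 7)²`) is not attained: a `22`-point code would give each point valencies
`A + B = 21`, `1·A + 7 = 4·B`, impossible in natural numbers.
(Integrality test of Boyvalenkov–Landgev 1995 for `L₃`; certified `L₃ − 1` row of the `pub-packcert` grid.) -/
theorem code_dim7_seventh_le_21 (C : Finset (EuclideanSpace ℝ (Fin 7)))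
    (h1 : ∀ x ∈ C, ‖x‖ = 1) (h2 : ∀ x ∈ C, ∀ y ∈ C, x ≠ y → inner ℝ x y ≤ 1 / 7) :
    C.card ≤ 21 := by
  have h := degree_three_card_le_of_no_valency (n := 7) (μ := 5 / 2) (by norm_num) (by norm_num)
    (1 / 7) (4 / 7) (by norm_num) (by norm_num) (by norm_num) (by norm_num) 22 (by norm_num)
    (by norm_num)
    (fun A B hAB h => by
      have h' : (1 : ℝ) * A + 7 = 4 * B := by linarith
      have h'' : 1 * A + 7 = 4 * B := by exact_mod_cast h'
      omega)
    C h1 h2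
  omega

/-- **`A(7, arccos 1/5) ≤ 27`**: every finite set of unit vectors of `ℝ^7` with pairwise inner
products `≤ 1 / 5` has at most `27` elements. Levenshtein's `L₃(7, 1 / 5) = 28` (cubic certificate
`(t - 1 / 5)(t + 1 / 2)²`) is not attained: a `28`-point code would give each point valencies
`A + B = 27`, `2·A + 10 = 5·B`, impossible in natural numbers.
(Integrality test of Boyvalenkov–Landgev 1995 for `L₃`; certified `L₃ − 1` row of the `pub-packcert` grid.) -/
theorem code_dim7_fifth_le_27 (C : Finset (EuclideanSpace ℝ (Fin 7)))
    (h1 : ∀ x ∈ C, ‖x‖ = 1) (h2 : ∀ x ∈ C, ∀ y ∈ C, x ≠ y → inner ℝ x y ≤ 1 / 5) :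
    C.card ≤ 27 := by
  have h := degree_three_card_le_of_no_valency (n := 7) (μ := 5 / 2) (by norm_num) (by norm_num)
    (1 / 5) (1 / 2) (by norm_num) (by norm_num) (by norm_num) (by norm_num) 28 (by norm_num)
    (by norm_num)
    (fun A B hAB h => by
      have h' : (2 : ℝ) * A + 10 = 5 * B := by linarith
      have h'' : 2 * A + 10 = 5 * B := by exact_mod_cast h'
      omega)
    C h1 h2
  omega

/-- **`A(8, arccos 1/8) ≤ 24`**: every finite set of unit vectors of `ℝ^8` with pairwise inner
products `≤ 1 / 8` has at most `24` elements. Levenshtein's `L₃(8, 1 / 8) = 25` (cubic certificate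
`(t - 1 / 8)(t + 9 / 16)²`) is not attained: a `25`-point code would give each point valencies
`A + B = 24`, `2·A + 16 = 9·B`, impossible in natural numbers.
(Integrality test of Boyvalenkov–Landgev 1995 for `L₃`; certified `L₃ − 1` row of the `pub-packcert` grid.) -/
theorem code_dim8_eighth_le_24 (C : Finset (EuclideanSpace ℝ (Fin 8)))
    (h1 : ∀ x ∈ C, ‖x‖ = 1) (h2 : ∀ x ∈ C, ∀ y ∈ C, x ≠ y → inner ℝ x y ≤ 1 / 8) :
    C.card ≤ 24 := by
  have h := degree_three_card_le_of_no_valency (n := 8) (μ := 3) (by norm_num) (by norm_num)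
    (1 / 8) (9 / 16) (by norm_num) (by norm_num) (by norm_num) (by norm_num) 25 (by norm_num)
    (by norm_num)
    (fun A B hAB h => by
      have h' : (2 : ℝ) * A + 16 = 9 * B := by linarith
      have h'' : 2 * A + 16 = 9 * B := by exact_mod_cast h'
      omega)
    C h1 h2
  omega

/-- **`A(8, arccos 1/6) ≤ 29`**: every finite set of unit vectors of `ℝ^8` with pairwise inner
products `≤ 1 / 6` has at most `29` elements. Levenshtein's `L₃(8, 1 / 6) = 30` (cubic certificate
`(t - 1 / 6)(t + 1 / 2)²`) is not attained: a `30`-point code would give each point valencies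
`A + B = 29`, `1·A + 6 = 3·B`, impossible in natural numbers.
(Integrality test of Boyvalenkov–Landgev 1995 for `L₃`; certified `L₃ − 1` row of the `pub-packcert` grid.) -/
theorem code_dim8_sixth_le_29 (C : Finset (EuclideanSpace ℝ (Fin 8)))
    (h1 : ∀ x ∈ C, ‖x‖ = 1) (h2 : ∀ x ∈ C, ∀ y ∈ C, x ≠ y → inner ℝ x y ≤ 1 / 6) :
    C.card ≤ 29 := by
  have h := degree_three_card_le_of_no_valency (n := 8) (μ := 3) (by norm_num) (by norm_num)
    (1 / 6) (1 / 2) (by norm_num) (by norm_num) (by norm_num) (by norm_num) 30 (by norm_num)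
    (by norm_num)
    (fun A B hAB h => by
      have h' : (1 : ℝ) * A + 6 = 3 * B := by linarith
      have h'' : 1 * A + 6 = 3 * B := by exact_mod_cast h'
      omega)
    C h1 h2
  omega

/-- **`A(9, arccos 1/5) ≤ 44`**: every finite set of unit vectors of `ℝ^9` with pairwise inner
products `≤ 1 / 5` has at most `44` elements. Levenshtein's `L₃(9, 1 / 5) = 45` (cubic certificate
`(t - 1 / 5)(t + 3 / 7)²`) is not attained: a `45`-point code would give each point valencies
`A + B = 44`, `7·A + 35 = 15·B`, impossible in natural numbers.
(Integrality test of Boyvalenkov–Landgev 1995 for `L₃`; certified `L₃ − 1` row of the `pub-packcert` grid.) -/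
theorem code_dim9_fifth_le_44 (C : Finset (EuclideanSpace ℝ (Fin 9)))
    (h1 : ∀ x ∈ C, ‖x‖ = 1) (h2 : ∀ x ∈ C, ∀ y ∈ C, x ≠ y → inner ℝ x y ≤ 1 / 5) :
    C.card ≤ 44 := by
  have h := degree_three_card_le_of_no_valency (n := 9) (μ := 7 / 2) (by norm_num) (by norm_num)
    (1 / 5) (3 / 7) (by norm_num) (by norm_num) (by norm_num) (by norm_num) 45 (by norm_num)
    (by norm_num)
    (fun A B hAB h => by
      have h' : (7 : ℝ) * A + 35 = 15 * B := by linarith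
      have h'' : 7 * A + 35 = 15 * B := by exact_mod_cast h'
      omega)
    C h1 h2
  omega

/-- **`A(10, arccos 1/10) ≤ 30`**: every finite set of unit vectors of `ℝ^10` with pairwise inner
products `≤ 1 / 10` has at most `30` elements. Levenshtein's `L₃(10, 1 / 10) = 31` (cubic certificate
`(t - 1 / 10)(t + 11 / 20)²`) is not attained: a `31`-point code would give each point valencies
`A + B = 30`, `2·A + 20 = 11·B`, impossible in natural numbers.
(Integrality test of Boyvalenkov–Landgev 1995 for `L₃`; certified `L₃ − 1` row of the `pub-packcert` grid.) -/
theorem code_dim10_tenth_le_30 (C : Finset (EuclideanSpace ℝ (Fin 10)))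
    (h1 : ∀ x ∈ C, ‖x‖ = 1) (h2 : ∀ x ∈ C, ∀ y ∈ C, x ≠ y → inner ℝ x y ≤ 1 / 10) :
    C.card ≤ 30 := by
  have h := degree_three_card_le_of_no_valency (n := 10) (μ := 4) (by norm_num) (by norm_num)
    (1 / 10) (11 / 20) (by norm_num) (by norm_num) (by norm_num) (by norm_num) 31 (by norm_num)
    (by norm_num)
    (fun A B hAB h => by
      have h' : (2 : ℝ) * A + 20 = 11 * B := by linarith
      have h'' : 2 * A + 20 = 11 * B := by exact_mod_cast h'
      omega)
    C h1 h2
  omega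

/-- **`A(10, arccos 1/8) ≤ 34`**: every finite set of unit vectors of `ℝ^10` with pairwise inner
products `≤ 1 / 8` has at most `34` elements. Levenshtein's `L₃(10, 1 / 8) = 35` (cubic certificate
`(t - 1 / 8)(t + 1 / 2)²`) is not attained: a `35`-point code would give each point valencies
`A + B = 34`, `1·A + 8 = 4·B`, impossible in natural numbers.
(Integrality test of Boyvalenkov–Landgev 1995 for `L₃`; certified `L₃ − 1` row of the `pub-packcert` grid.) -/
theorem code_dim10_eighth_le_34 (C : Finset (EuclideanSpace ℝ (Fin 10)))
    (h1 : ∀ x ∈ C, ‖x‖ = 1) (h2 : ∀ x ∈ C, ∀ y ∈ C, x ≠ y → inner ℝ x y ≤ 1 / 8) :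
    C.card ≤ 34 := by
  have h := degree_three_card_le_of_no_valency (n := 10) (μ := 4) (by norm_num) (by norm_num)
    (1 / 8) (1 / 2) (by norm_num) (by norm_num) (by norm_num) (by norm_num) 35 (by norm_num)
    (by norm_num)
    (fun A B hAB h => by
      have h' : (1 : ℝ) * A + 8 = 4 * B := by linarith
      have h'' : 1 * A + 8 = 4 * B := by exact_mod_cast h'
      omega)
    C h1 h2
  omega

/-- **`A(11, arccos 1/11) ≤ 33`**: every finite set of unit vectors of `ℝ^11` with pairwise inner
products `≤ 1 / 11` has at most `33` elements. Levenshtein's `L₃(11, 1 / 11) = 34` (cubic certificate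
`(t - 1 / 11)(t + 6 / 11)²`) is not attained: a `34`-point code would give each point valencies
`A + B = 33`, `1·A + 11 = 6·B`, impossible in natural numbers.
(Integrality test of Boyvalenkov–Landgev 1995 for `L₃`; certified `L₃ − 1` row of the `pub-packcert` grid.) -/
theorem code_dim11_eleventh_le_33 (C : Finset (EuclideanSpace ℝ (Fin 11)))
    (h1 : ∀ x ∈ C, ‖x‖ = 1) (h2 : ∀ x ∈ C, ∀ y ∈ C, x ≠ y → inner ℝ x y ≤ 1 / 11) :
    C.card ≤ 33 := by
  have h := degree_three_card_le_of_no_valency (n := 11) (μ := 9 / 2) (by norm_num) (by norm_num)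
    (1 / 11) (6 / 11) (by norm_num) (by norm_num) (by norm_num) (by norm_num) 34 (by norm_num)
    (by norm_num)
    (fun A B hAB h => by
      have h' : (1 : ℝ) * A + 11 = 6 * B := by linarith
      have h'' : 1 * A + 11 = 6 * B := by exact_mod_cast h'
      omega)
    C h1 h2
  omega

/-- **`A(13, arccos 1/5) ≤ 103`**: every finite set of unit vectors of `ℝ^13` with pairwise inner
products `≤ 1 / 5` has at most `103` elements. Levenshtein's `L₃(13, 1 / 5) = 104` (cubic certificate
`(t - 1 / 5)(t + 1 / 3)²`) is not attained: a `104`-point code would give each point valencies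
`A + B = 103`, `3·A + 15 = 5·B`, impossible in natural numbers.
(Integrality test of Boyvalenkov–Landgev 1995 for `L₃`; certified `L₃ − 1` row of the `pub-packcert` grid.) -/
theorem code_dim13_fifth_le_103 (C : Finset (EuclideanSpace ℝ (Fin 13)))
    (h1 : ∀ x ∈ C, ‖x‖ = 1) (h2 : ∀ x ∈ C, ∀ y ∈ C, x ≠ y → inner ℝ x y ≤ 1 / 5) :
    C.card ≤ 103 := by
  have h := degree_three_card_le_of_no_valency (n := 13) (μ := 11 / 2) (by norm_num) (by norm_num)
    (1 / 5) (1 / 3) (by norm_num) (by norm_num) (by norm_num) (by norm_num) 104 (by norm_num)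
    (by norm_num)
    (fun A B hAB h => by
      have h' : (3 : ℝ) * A + 15 = 5 * B := by linarith
      have h'' : 3 * A + 15 = 5 * B := by exact_mod_cast h'
      omega)
    C h1 h2
  omega

/-- **`A(16, arccos 1/6) ≤ 115`**: every finite set of unit vectors of `ℝ^16` with pairwise inner
products `≤ 1 / 6` has at most `115` elements. Levenshtein's `L₃(16, 1 / 6) = 116` (cubic certificate
`(t - 1 / 6)(t + 7 / 22)²`) is not attained: a `116`-point code would give each point valencies
`A + B = 115`, `11·A + 66 = 21·B`, impossible in natural numbers.
(Integrality test of Boyvalenkov–Landgev 1995 for `L₃`; certified `L₃ − 1` row of the `pub-packcert` grid.) -/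
theorem code_dim16_sixth_le_115 (C : Finset (EuclideanSpace ℝ (Fin 16)))
    (h1 : ∀ x ∈ C, ‖x‖ = 1) (h2 : ∀ x ∈ C, ∀ y ∈ C, x ≠ y → inner ℝ x y ≤ 1 / 6) :
    C.card ≤ 115 := by
  have h := degree_three_card_le_of_no_valency (n := 16) (μ := 7) (by norm_num) (by norm_num)
    (1 / 6) (7 / 22) (by norm_num) (by norm_num) (by norm_num) (by norm_num) 116 (by norm_num)
    (by norm_num)
    (fun A B hAB h => by
      have h' : (11 : ℝ) * A + 66 = 21 * B := by linarith
      have h'' : 11 * A + 66 = 21 * B := by exact_mod_cast h'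
      omega)
    C h1 h2
  omega

/-- **`A(17, arccos 1/7) ≤ 101`**: every finite set of unit vectors of `ℝ^17` with pairwise inner
products `≤ 1 / 7` has at most `101` elements. Levenshtein's `L₃(17, 1 / 7) = 102` (cubic certificate
`(t - 1 / 7)(t + 1 / 3)²`) is not attained: a `102`-point code would give each point valencies
`A + B = 101`, `3·A + 21 = 7·B`, impossible in natural numbers.
(Integrality test of Boyvalenkov–Landgev 1995 for `L₃`; certified `L₃ − 1` row of the `pub-packcert` grid.) -/
theorem code_dim17_seventh_le_101 (C : Finset (EuclideanSpace ℝ (Fin 17)))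
    (h1 : ∀ x ∈ C, ‖x‖ = 1) (h2 : ∀ x ∈ C, ∀ y ∈ C, x ≠ y → inner ℝ x y ≤ 1 / 7) :
    C.card ≤ 101 := by
  have h := degree_three_card_le_of_no_valency (n := 17) (μ := 15 / 2) (by norm_num) (by norm_num)
    (1 / 7) (1 / 3) (by norm_num) (by norm_num) (by norm_num) (by norm_num) 102 (by norm_num)
    (by norm_num)
    (fun A B hAB h => by
      have h' : (3 : ℝ) * A + 21 = 7 * B := by linarith
      have h'' : 3 * A + 21 = 7 * B := by exact_mod_cast h'
      omega)
    C h1 h2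
  omega

/-- **`A(18, arccos 1/6) ≤ 154`**: every finite set of unit vectors of `ℝ^18` with pairwise inner
products `≤ 1 / 6` has at most `154` elements. Levenshtein's `L₃(18, 1 / 6) = 155` (cubic certificate
`(t - 1 / 6)(t + 7 / 24)²`) is not attained: a `155`-point code would give each point valencies
`A + B = 154`, `4·A + 24 = 7·B`, impossible in natural numbers.
(Integrality test of Boyvalenkov–Landgev 1995 for `L₃`; certified `L₃ − 1` row of the `pub-packcert` grid.) -/
theorem code_dim18_sixth_le_154 (C : Finset (EuclideanSpace ℝ (Fin 18)))
    (h1 : ∀ x ∈ C, ‖x‖ = 1) (h2 : ∀ x ∈ C, ∀ y ∈ C, x ≠ y → inner ℝ x y ≤ 1 / 6) :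
    C.card ≤ 154 := by
  have h := degree_three_card_le_of_no_valency (n := 18) (μ := 8) (by norm_num) (by norm_num)
    (1 / 6) (7 / 24) (by norm_num) (by norm_num) (by norm_num) (by norm_num) 155 (by norm_num)
    (by norm_num)
    (fun A B hAB h => by
      have h' : (4 : ℝ) * A + 24 = 7 * B := by linarith
      have h'' : 4 * A + 24 = 7 * B := by exact_mod_cast h'
      omega)
    C h1 h2
  omega

/-- **`A(21, arccos 1/6) ≤ 237`**: every finite set of unit vectors of `ℝ^21` with pairwise inner
products `≤ 1 / 6` has at most `237` elements. Levenshtein's `L₃(21, 1 / 6) = 238` (cubic certificate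
`(t - 1 / 6)(t + 7 / 27)²`) is not attained: a `238`-point code would give each point valencies
`A + B = 237`, `9·A + 54 = 14·B`, impossible in natural numbers.
(Integrality test of Boyvalenkov–Landgev 1995 for `L₃`; certified `L₃ − 1` row of the `pub-packcert` grid.) -/
theorem code_dim21_sixth_le_237 (C : Finset (EuclideanSpace ℝ (Fin 21)))
    (h1 : ∀ x ∈ C, ‖x‖ = 1) (h2 : ∀ x ∈ C, ∀ y ∈ C, x ≠ y → inner ℝ x y ≤ 1 / 6) :
    C.card ≤ 237 := by
  have h := degree_three_card_le_of_no_valency (n := 21) (μ := 19 / 2) (by norm_num) (by norm_num)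
    (1 / 6) (7 / 27) (by norm_num) (by norm_num) (by norm_num) (by norm_num) 238 (by norm_num)
    (by norm_num)
    (fun A B hAB h => by
      have h' : (9 : ℝ) * A + 54 = 14 * B := by linarith
      have h'' : 9 * A + 54 = 14 * B := by exact_mod_cast h'
      omega)
    C h1 h2
  omega

/-- **`A(22, arccos 1/8) ≤ 142`**: every finite set of unit vectors of `ℝ^22` with pairwise inner
products `≤ 1 / 8` has at most `142` elements. Levenshtein's `L₃(22, 1 / 8) = 143` (cubic certificate
`(t - 1 / 8)(t + 3 / 10)²`) is not attained: a `143`-point code would give each point valencies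
`A + B = 142`, `5·A + 40 = 12·B`, impossible in natural numbers.
(Integrality test of Boyvalenkov–Landgev 1995 for `L₃`; certified `L₃ − 1` row of the `pub-packcert` grid.) -/
theorem code_dim22_eighth_le_142 (C : Finset (EuclideanSpace ℝ (Fin 22)))
    (h1 : ∀ x ∈ C, ‖x‖ = 1) (h2 : ∀ x ∈ C, ∀ y ∈ C, x ≠ y → inner ℝ x y ≤ 1 / 8) :
    C.card ≤ 142 := by
  have h := degree_three_card_le_of_no_valency (n := 22) (μ := 10) (by norm_num) (by norm_num)
    (1 / 8) (3 / 10) (by norm_num) (by norm_num) (by norm_num) (by norm_num) 143 (by norm_num)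
    (by norm_num)
    (fun A B hAB h => by
      have h' : (5 : ℝ) * A + 40 = 12 * B := by linarith
      have h'' : 5 * A + 40 = 12 * B := by exact_mod_cast h'
      omega)
    C h1 h2
  omega

end Summit.Ventures.PackingBounds.SphericalCodes
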